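import Literature.NumberTheory.EllipticCurves.SqrtTwoTwistBrewerOneModEight
import Literature.NumberTheory.EllipticCurves.SqrtTwoTwistEntireLFunction
import HarnessLib

/-!
# The remaining leaf: Brewer's character sum at `p ≡ 3 (mod 8)` (named fact), and the `j = 8000` continuation modulo it

Topic `Literature/NumberTheory/EllipticCurves`, namespace `Literature.NumberTheory.EllipticCurves.SqrtTwoTwist` (sequel to
`SqrtTwoTwistBrewerOneModEight`, `SqrtTwoTwistEntireLFunction`).  ONE named fact (the `p ≡ 3 (mod 8)` clause of
`Brewer1961_characterSum`, whose `p ≡ 1 (mod 8)` clause is the THEOREM `brewer_characterSum_of_mod_eight_eq_one`) and the re-based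
consequences:

* `Brewer1961_characterSum_three` — for a prime `p ≡ 3 (mod 8)`, `p = c² + 2d²`, `c ≡ (−1)^{⌊p/8⌋+1} (mod 4)`:
  `Σ_x ((x + 2)(x² − 2)/p) = 2c` (Brewer 1961; Leonard–Williams 1975, the case `p = 8k + 3`, proved in print with Eisenstein sums over
  `𝔽_{p²}` — Lemmas 4.3–4.4 and (5.4)–(5.8); the `2`-Sylow argument of `SqrtTwoTwistBrewerOneModEight` does not see the sign here, the
  `2`-Sylow of `B₁(𝔽_p)` being `ℤ/2`);
* `brewer1961_characterSum_of_three` — **`Brewer1961_characterSum_three → Brewer1961_characterSum`**;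
* ★ `hasEntireLFunction_of_brewer_three` — **`L(B_n, s)` is entire for every square-free `n`, modulo `Brewer1961_characterSum_three` only**.

Nothing about BSD is proved here.

## References
* B. W. Brewer, *On certain character sums*, Trans. AMS 99 (1961), 241–245. [Brewer1961]
* P. A. Leonard, K. S. Williams, *Jacobi sums and a theorem of Brewer*, Rocky Mountain J. Math. 5 (1975), 301–308. [LeonardWilliams1975]

## Mathlib / tree search
Tree: `SqrtTwoTwist.{Brewer1961_characterSum, brewerSum}` (`SqrtTwoTwistBrewer`), `brewer_characterSum_of_mod_eight_eq_one`
(`SqrtTwoTwistBrewerOneModEight`), `hasEntireLFunction_of_brewer_of_squarefree` (`SqrtTwoTwistEntireLFunction`).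
-/

noncomputable section

namespace Literature.NumberTheory.EllipticCurves

namespace SqrtTwoTwist

/-- **Brewer's theorem, the clause `p ≡ 3 (mod 8)`** (named fact; Brewer, Trans. AMS 99 (1961); Leonard–Williams, Rocky Mountain J. Math.
5 (1975), Theorem p. 301, case `p = 8k + 3`): for a prime `p ≡ 3 (mod 8)` and `p = c² + 2d²` with `c ≡ (−1)^{k+1} (mod 4)`, `k = ⌊p/8⌋`,
Brewer's sum `B = Σ_{x=0}^{p−1} ((x + 2)(x² − 2)/p)` equals `2c`.  Printed proof: Eisenstein sums `K = Σ_b X(1 + bi)` over `𝔽_{p²}`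
(Leonard–Williams Lemmas 4.3–4.4, (5.4)–(5.8), after Whiteman 1963).  Not in Mathlib or the tree.  The companion clause `p ≡ 1 (mod 8)` is
the theorem `brewer_characterSum_of_mod_eight_eq_one`.  Checked numerically for every `p < 700` (seat folder `kit/check_brewer.py`).
[cite: LeonardWilliams1975, Theorem (p. 301), case p = 8k+3] [cite: Brewer1961, Theorem 2] -/
def Brewer1961_characterSum_three : Prop :=
  ∀ (p : ℕ) [Fact p.Prime], p % 8 = 3 → ∀ (c d : ℤ), (p : ℤ) = c ^ 2 + 2 * d ^ 2 →
    c % 4 = (if (p / 8) % 2 = 0 then 3 else 1) → brewerSum (ZMod p) = 2 * c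

/-- **`Brewer1961_characterSum_three → Brewer1961_characterSum`**: the `p ≡ 1 (mod 8)` clause is proved
(`brewer_characterSum_of_mod_eight_eq_one`). [cite: LeonardWilliams1975, Theorem (p. 301)] -/
theorem brewer1961_characterSum_of_three (h3 : Brewer1961_characterSum_three) : Brewer1961_characterSum := by
  intro p _ hp8 c d hcd hc4
  rcases hp8 with h1 | h3'
  · exact brewer_characterSum_of_mod_eight_eq_one h1 hcd hc4
  · exact h3 p h3' c d hcd hc4

/-- ★ **`L(B_n, s)` is entire for every square-free `n`, modulo Brewer's `p ≡ 3 (mod 8)` clause only** (`B_n = ⟨0, 4n, 0, 2n², 0⟩`,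
`j = 8000`): `hasEntireLFunction_of_brewer_of_squarefree` re-based on the reduced leaf.
[cite: Rajwade1968, Thm. 1 and §5] [cite: LeonardWilliams1975, Theorem (p. 301)] -/
theorem hasEntireLFunction_of_brewer_three (h3 : Brewer1961_characterSum_three) {n : ℤ} (hn : Squarefree n) :
    (⟨0, 4 * (n : ℚ), 0, 2 * (n : ℚ) ^ 2, 0⟩ : WeierstrassCurve ℚ).HasEntireLFunction :=
  hasEntireLFunction_of_brewer_of_squarefree (brewer1961_characterSum_of_three h3) hn

end SqrtTwoTwist

end Literature.NumberTheory.EllipticCurves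

end
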